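import Mathlib
import Summits.NavierStokesRegularity.NavierStokesRegularity.Theorems.EulerZoomLiouvillePowerGaugeEulerLiouvilleSelfSimilarEndpointFlux
import Literature.Analysis.FunctionSpaces.SobolevDomain
import HarnessLib

/-!
# Rung C1 of the crux `EulerZoomLiouville.PowerGaugeEulerLiouville` at the endpoint `ρ = 1/2`:
# the shell flux inequality from the profile local energy EQUALITY (test-function form)

Route №10 `EulerZoomLiouville` (NavierStokesRegularity), crux E = stmt-NavierStokesRegularity-19832,
registered open stub `stub_selfSimilarWeakRest`, endpoint `ρ = 1/2` (`γ = 2/5`).  The tree's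
`shell_energy_le_flux_of_profileLEI_half` (`…SelfSimilarEndpointFlux`) derives Chae–Shvydkoy's
starting inequality (3.2),
`∫_{L ≤ |y| < 2L} |V|² ≤ (K/L) ∫_{L/4 ≤ |y| ≤ 8L} (|V|³ + 2|P||V|)`,
from the TIME-DEPENDENT forward profile local energy inequality, which the tree only derives for
members exactly self-similar about the ORIGIN (`selfSimilar_profile_energy_le_add_flux`).  For members
exactly self-similar about `(T, x₀)` on a past sub-slab the tree's dictionary
(`Past.profileData_of_past`) delivers instead the profile local energy EQUALITY in test-function form,
`(2 − 5γ) ∫ σ|V|² = ∫ (|V|² + 2P) ⟪V, ∇σ⟫ + γ ∫ |V|² ⟪y, ∇σ⟫` (every test function `σ`).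
This file derives (3.2) directly from that identity, with no time variable:

* `EndpointFlux.hasDerivAt_bumpEnergy` — for a smooth compactly supported `σ` and `|V|² ∈ L¹_loc`,
  the bump energy `E(s) = ∫ |V(y)|² σ(s y) dy` is differentiable in the scale `s > 0` with
  `E'(s) = ∫ |V(y)|² Dσ(s y)[y] dy` (differentiation under the integral sign,
  `hasDerivAt_integral_of_dominated_loc_of_deriv_le`);
* `EndpointFlux.shell_energy_le_flux_of_profileEE_half` — at `γ = 2/5` the identity applied to
  `σ(s ·)` reads `γ E'(s) = −∫ (|V|² + 2P) Dσ(s y)[V y]`, whose modulus is `≤ K_σ ∫_{L/4≤|y|≤8L}(|V|³+2|P||V|)`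
  for `s ∈ [1/(4L), 1/L]` (radial bump: `∇σ` lives on `1/2 ≤ |x| ≤ 1`); the mean value inequality on
  that interval bounds `E(1/(4L)) − E(1/L) ≥ ∫_{L≤|y|<2L}|V|²` by `(15 K_σ / 8L) ∫_{L/4≤|y|≤8L}(…)` —
  the SAME conclusion as the tree's lemma, from the hypotheses `|V|², |V|³, |P||V| ∈ L¹_loc` + the
  energy equality.

WHAT THIS IS NOT: not NS, not E, not the stub — a profile-level tool making the endpoint chain
available to past/shifted members. [cite: ChaeShvydkoy2013, §3.1 eq. (3.1)–(3.2)]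
-/

noncomputable section

-- flat `Theorems/<Route><Decl>…` files of one crux share the namespace of the crux (tree convention)
set_option linter.dupNamespace false

open MeasureTheory Set Filter Topology Metric Function
open scoped ENNReal NNReal InnerProductSpace RealInnerProductSpace

namespace Summit.NavierStokesRegularity.NavierStokesRegularity.Theorems.PowerGaugeEulerLiouville

open Literature.Analysis Literature.Analysis.FunctionSpaces

namespace EndpointFlux

variable {V : EuclideanSpace ℝ (Fin 3) → EuclideanSpace ℝ (Fin 3)} {P : EuclideanSpace ℝ (Fin 3) → ℝ}

/-- A smooth compactly supported function has a bounded derivative. [folklore] -/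
theorem exists_norm_fderiv_le {σ : EuclideanSpace ℝ (Fin 3) → ℝ} (hσ : ContDiff ℝ (⊤ : ℕ∞) σ)
    (hσc : HasCompactSupport σ) : ∃ K : ℝ, 0 ≤ K ∧ ∀ x, ‖fderiv ℝ σ x‖ ≤ K := by
  obtain ⟨C, hC⟩ := (hσc.fderiv ℝ).exists_bound_of_continuous (hσ.continuous_fderiv (by simp))
  exact ⟨max C 0, le_max_right _ _, fun x => (hC x).trans (le_max_left _ _)⟩

/-- `⟪∇σ(x), w⟫ = Dσ(x)[w]`. [folklore] -/
theorem inner_gradient_eq_fderiv (σ : EuclideanSpace ℝ (Fin 3) → ℝ) (x w : EuclideanSpace ℝ (Fin 3)) :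
    ⟪gradient σ x, w⟫ = fderiv ℝ σ x w := by
  rw [gradient, InnerProductSpace.toDual_symm_apply]

/-- The derivative of a scaled function: `D(σ(s ·))(y)[w] = s · Dσ(s y)[w]`. [folklore] -/
theorem fderiv_comp_smul_apply {σ : EuclideanSpace ℝ (Fin 3) → ℝ} (hσ : ContDiff ℝ (⊤ : ℕ∞) σ)
    (s : ℝ) (y w : EuclideanSpace ℝ (Fin 3)) :
    fderiv ℝ (fun z => σ (s • z)) y w = s * fderiv ℝ σ (s • y) w := by
  have hd : DifferentiableAt ℝ σ (s • y) := (hσ.differentiable (by simp)).differentiableAt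
  have h : HasFDerivAt (fun z : EuclideanSpace ℝ (Fin 3) => σ (s • z))
      ((fderiv ℝ σ (s • y)).comp (s • ContinuousLinearMap.id ℝ (EuclideanSpace ℝ (Fin 3)))) y :=
    hd.hasFDerivAt.comp y ((hasFDerivAt_id y).const_smul s)
  rw [h.fderiv]
  simp [smul_eq_mul]

/-- The derivative of a bump vanishes outside the unit ball if the bump does. [folklore] -/
theorem fderiv_eq_zero_of_one_lt {σ : EuclideanSpace ℝ (Fin 3) → ℝ}
    (hσzero : ∀ x, 1 ≤ ‖x‖ → σ x = 0) {x : EuclideanSpace ℝ (Fin 3)} (hx : 1 < ‖x‖) :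
    fderiv ℝ σ x = 0 := by
  have hopen : IsOpen {y : EuclideanSpace ℝ (Fin 3) | 1 < ‖y‖} := isOpen_lt continuous_const continuous_norm
  have h : σ =ᶠ[𝓝 x] fun _ => (0 : ℝ) := by
    filter_upwards [hopen.mem_nhds hx] with y hy
    exact hσzero y (le_of_lt hy)
  rw [h.fderiv_eq, fderiv_const_apply]

/-- **The bump energy is differentiable in the scale.**  For `|V|² ∈ L¹_loc`, a smooth `σ` vanishing
on `{|x| ≥ 1}`, and `s₀ > 0`, the function `E(s) = ∫ |V(y)|² σ(s • y) dy` has derivative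
`E'(s₀) = ∫ |V(y)|² Dσ(s₀ • y)[y] dy` at `s₀` (dominated differentiation: for `s > s₀/2` the
integrand's `s`-derivative lives in `|y| ≤ 2/s₀` and is bounded by `(2K/s₀)|V|²` there). [folklore] -/
theorem hasDerivAt_bumpEnergy (hV2 : LocallyIntegrable (fun y => ‖V y‖ ^ 2) volume)
    {σ : EuclideanSpace ℝ (Fin 3) → ℝ} (hσ : ContDiff ℝ (⊤ : ℕ∞) σ)
    (hσzero : ∀ x, 1 ≤ ‖x‖ → σ x = 0) {s₀ : ℝ} (hs₀ : 0 < s₀) :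
    HasDerivAt (fun s : ℝ => ∫ y, ‖V y‖ ^ 2 * σ (s • y))
      (∫ y, ‖V y‖ ^ 2 * fderiv ℝ σ (s₀ • y) y) s₀ := by
  have hσc : HasCompactSupport σ := by
    refine HasCompactSupport.of_support_subset_isCompact (isCompact_closedBall (0 : EuclideanSpace ℝ (Fin 3)) 1) ?_
    intro x hx
    rw [mem_closedBall, dist_zero_right]
    by_contra h
    exact hx (hσzero x (le_of_lt (not_le.1 h)))
  obtain ⟨K, hK0, hK⟩ := exists_norm_fderiv_le hσ hσc
  have hVm : AEStronglyMeasurable (fun y => ‖V y‖ ^ 2) volume := hV2.aestronglyMeasurable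
  -- the data for `hasDerivAt_integral_of_dominated_loc_of_deriv_le`
  set F : ℝ → EuclideanSpace ℝ (Fin 3) → ℝ := fun s y => ‖V y‖ ^ 2 * σ (s • y) with hF
  set F' : ℝ → EuclideanSpace ℝ (Fin 3) → ℝ := fun s y => ‖V y‖ ^ 2 * fderiv ℝ σ (s • y) y with hF'
  set R : ℝ := 2 / s₀ with hR
  set bound : EuclideanSpace ℝ (Fin 3) → ℝ := fun y =>
    K * R * (closedBall (0 : EuclideanSpace ℝ (Fin 3)) R).indicator (fun y => ‖V y‖ ^ 2) y with hbound
  have hball : ball s₀ (s₀ / 2) ∈ 𝓝 s₀ := ball_mem_nhds _ (by positivity)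
  have hF_meas : ∀ᶠ s in 𝓝 s₀, AEStronglyMeasurable (F s) volume :=
    Eventually.of_forall fun s =>
      hVm.mul (hσ.continuous.comp (continuous_const_smul s)).aestronglyMeasurable
  have hF_int : Integrable (F s₀) volume := by
    have h := hV2.integrable_smul_left_of_hasCompactSupport
      (hσ.continuous.comp (continuous_const_smul s₀)) (hσc.comp_smul hs₀.ne')
    simpa [hF, smul_eq_mul, mul_comm] using h
  have hcontF' : Continuous fun y : EuclideanSpace ℝ (Fin 3) => fderiv ℝ σ (s₀ • y) y :=
    ((hσ.continuous_fderiv (by simp)).comp (continuous_const_smul s₀)).clm_apply continuous_id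
  have hF'_meas : AEStronglyMeasurable (F' s₀) volume := hVm.mul hcontF'.aestronglyMeasurable
  have h_bound : ∀ᵐ y ∂volume, ∀ s ∈ ball s₀ (s₀ / 2), ‖F' s y‖ ≤ bound y := by
    refine Eventually.of_forall fun y s hs => ?_
    rw [mem_ball, Real.dist_eq] at hs
    have hs' : s₀ / 2 < s := by
      have := (abs_lt.1 hs).1; linarith
    have hs0 : 0 < s := lt_trans (by positivity) hs'
    by_cases hy : y ∈ closedBall (0 : EuclideanSpace ℝ (Fin 3)) R
    · rw [hbound]; dsimp only; rw [indicator_of_mem hy, hF']; dsimp only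
      rw [mem_closedBall, dist_zero_right] at hy
      rw [norm_mul, Real.norm_of_nonneg (sq_nonneg _)]
      calc ‖V y‖ ^ 2 * ‖fderiv ℝ σ (s • y) y‖ ≤ ‖V y‖ ^ 2 * (K * R) := by
            refine mul_le_mul_of_nonneg_left ?_ (sq_nonneg _)
            exact (ContinuousLinearMap.le_opNorm _ _).trans (mul_le_mul (hK _) hy (norm_nonneg _) hK0)
        _ = K * R * ‖V y‖ ^ 2 := by ring
    · -- outside `B̄_R`: `‖s • y‖ > 1`, so `Dσ(s • y) = 0`
      rw [mem_closedBall, dist_zero_right, not_le] at hy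
      have hsy : 1 < ‖s • y‖ := by
        rw [norm_smul, Real.norm_of_nonneg hs0.le]
        have h1 : (1 : ℝ) = (s₀ / 2) * R := by rw [hR]; field_simp
        rw [h1]
        exact mul_lt_mul' hs'.le hy (by positivity) hs0
      have hzero : F' s y = 0 := by
        rw [hF']; dsimp only
        rw [fderiv_eq_zero_of_one_lt hσzero hsy]; simp
      rw [hzero, norm_zero, hbound]; dsimp only
      rw [indicator_of_notMem (by rwa [mem_closedBall, dist_zero_right, not_le])]
      simp
  have hbound_int : Integrable bound volume := by
    have h := ((hV2.integrableOn_isCompact (isCompact_closedBall (0 : EuclideanSpace ℝ (Fin 3)) R)).integrable_indicator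
      measurableSet_closedBall).const_mul (K * R)
    exact h
  have h_diff : ∀ᵐ y ∂volume, ∀ s ∈ ball s₀ (s₀ / 2), HasDerivAt (F · y) (F' s y) s := by
    refine Eventually.of_forall fun y s _ => ?_
    have hd : DifferentiableAt ℝ σ (s • y) := (hσ.differentiable (by simp)).differentiableAt
    have h1 : HasDerivAt (fun s : ℝ => s • y) ((1 : ℝ) • y) s := (hasDerivAt_id s).smul_const y
    rw [one_smul] at h1
    have h2 : HasDerivAt (fun s : ℝ => σ (s • y)) (fderiv ℝ σ (s • y) y) s :=
      hd.hasFDerivAt.comp_hasDerivAt s h1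
    exact h2.const_mul (‖V y‖ ^ 2)
  exact (hasDerivAt_integral_of_dominated_loc_of_deriv_le hball hF_meas hF_int hF'_meas h_bound
    hbound_int h_diff).2

/-- **Shell flux inequality at the endpoint from the profile local energy EQUALITY** (Chae–Shvydkoy
(3.2) in the weak class, test-function route).  Let `V : ℝ³ → ℝ³`, `P : ℝ³ → ℝ` with
`|V|², |V|³, |P||V| ∈ L¹_loc`, and suppose the profile local energy equality of the class holds at
`γ = 2/5` (`ρ = 1/2`) for every test function: `(2 − 5γ)∫σ|V|² = ∫(|V|²+2P)⟪V,∇σ⟫ + γ∫|V|²⟪y,∇σ⟫`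
(the form delivered by `EnergySaturation.profileData_of_selfSimilar` / `Past.profileData_of_past`).
Then there is `K ≥ 0` with `∫_{L ≤ |y| < 2L} |V|² ≤ (K/L) ∫_{L/4 ≤ |y| ≤ 8L} (|V|³ + 2|P||V|)` for
every `L > 0` — the conclusion of the tree's `shell_energy_le_flux_of_profileLEI_half`, verbatim.
[cite: ChaeShvydkoy2013, §3.1 eq. (3.1)–(3.2)] -/
theorem shell_energy_le_flux_of_profileEE_half {γ : ℝ} (hγ : γ = 2 / 5)
    (hV2 : LocallyIntegrable (fun y => ‖V y‖ ^ 2) volume)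
    (hV3 : LocallyIntegrable (fun y => ‖V y‖ ^ 3) volume)
    (hPV : LocallyIntegrable (fun y => |P y| * ‖V y‖) volume)
    (hEE : ∀ σ : EuclideanSpace ℝ (Fin 3) → ℝ,
      IsTestFunctionOn (⊤ : TopologicalSpace.Opens (EuclideanSpace ℝ (Fin 3))) σ →
        (2 - 5 * γ) * ∫ x, σ x * ‖V x‖ ^ 2 =
          (∫ x, (‖V x‖ ^ 2 + 2 * P x) * ⟪V x, gradient σ x⟫) +
            γ * ∫ x, ‖V x‖ ^ 2 * ⟪x, gradient σ x⟫) :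
    ∃ K : ℝ, 0 ≤ K ∧ ∀ L : ℝ, 0 < L →
      ∫ y in {y | L ≤ ‖y‖ ∧ ‖y‖ < 2 * L}, ‖V y‖ ^ 2 ≤
        K / L * ∫ y in {y | L / 4 ≤ ‖y‖ ∧ ‖y‖ ≤ 8 * L}, (‖V y‖ ^ 3 + 2 * (|P y| * ‖V y‖)) := by
  subst hγ
  obtain ⟨σ, hσ, hσc, hσ0, hσ1, hσone, hσzero, hσgrad⟩ := exists_radialBump
  obtain ⟨Kσ, hKσ0, hKσ⟩ := exists_norm_fderiv_le hσ hσc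
  refine ⟨15 * Kσ / 8, by positivity, fun L hL => ?_⟩
  -- the shell integrand `F = |V|³ + 2|P||V|` and the big annulus `S`
  set F : EuclideanSpace ℝ (Fin 3) → ℝ := fun y => ‖V y‖ ^ 3 + 2 * (|P y| * ‖V y‖) with hF
  set S : Set (EuclideanSpace ℝ (Fin 3)) := {y | L / 4 ≤ ‖y‖ ∧ ‖y‖ ≤ 8 * L} with hS
  have hF0 : ∀ y, 0 ≤ F y := fun y => by rw [hF]; positivity
  have hFeq : F = (fun y => ‖V y‖ ^ 3) + (2 : ℝ) • fun y => |P y| * ‖V y‖ := by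
    funext y; simp only [hF, Pi.add_apply, Pi.smul_apply, smul_eq_mul]
  have hFloc : LocallyIntegrable F volume := by
    rw [hFeq]; exact hV3.add (hPV.smul (2 : ℝ))
  have hSmeas : MeasurableSet S :=
    (measurableSet_le measurable_const measurable_norm).inter
      (measurableSet_le measurable_norm measurable_const)
  have hSbdd : S ⊆ closedBall (0 : EuclideanSpace ℝ (Fin 3)) (8 * L) := fun y hy => by
    rw [mem_closedBall, dist_zero_right]; exact hy.2
  have hFS : IntegrableOn F S volume :=
    (hFloc.integrableOn_isCompact (isCompact_closedBall _ _)).mono_set hSbdd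
  set IF : ℝ := ∫ y in S, F y with hIF
  have hIF0 : 0 ≤ IF := setIntegral_nonneg hSmeas fun y _ => hF0 y
  -- the bump energy `E(s) = ∫ |V|² σ(s y)` and its derivative
  set E : ℝ → ℝ := fun s => ∫ y, ‖V y‖ ^ 2 * σ (s • y) with hE
  set E' : ℝ → ℝ := fun s => ∫ y, ‖V y‖ ^ 2 * fderiv ℝ σ (s • y) y with hE'
  have hderiv : ∀ s : ℝ, 0 < s → HasDerivAt E (E' s) s := fun s hs =>
    hasDerivAt_bumpEnergy hV2 hσ hσzero hs
  -- the energy identity at `σ(s ·)`: `(2/5) E'(s) = -∫ (|V|² + 2P) Dσ(s y)[V y]`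
  have hident : ∀ s : ℝ, 0 < s →
      (2 / 5 : ℝ) * E' s = -∫ y, (‖V y‖ ^ 2 + 2 * P y) * fderiv ℝ σ (s • y) (V y) := by
    intro s hs
    have htest : IsTestFunctionOn (⊤ : TopologicalSpace.Opens (EuclideanSpace ℝ (Fin 3)))
        (fun z => σ (s • z)) :=
      ⟨hσ.comp (contDiff_const_smul s), hσc.comp_smul hs.ne', fun _ _ => trivial⟩
    have h := hEE _ htest
    have e1 : ∀ y : EuclideanSpace ℝ (Fin 3), ⟪V y, gradient (fun z => σ (s • z)) y⟫ =
        s * fderiv ℝ σ (s • y) (V y) := fun y => by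
      rw [real_inner_comm, inner_gradient_eq_fderiv, fderiv_comp_smul_apply hσ]
    have e2 : ∀ y : EuclideanSpace ℝ (Fin 3), ⟪y, gradient (fun z => σ (s • z)) y⟫ =
        s * fderiv ℝ σ (s • y) y := fun y => by
      rw [real_inner_comm, inner_gradient_eq_fderiv, fderiv_comp_smul_apply hσ]
    simp only [e1, e2] at h
    norm_num at h
    -- `h : 0 = ∫ (|V|²+2P) (s Dσ(sy)[Vy]) + 2/5 ∫ |V|² (s Dσ(sy)[y])`
    have e3 : ∫ y, (‖V y‖ ^ 2 + 2 * P y) * (s * fderiv ℝ σ (s • y) (V y)) =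
        s * ∫ y, (‖V y‖ ^ 2 + 2 * P y) * fderiv ℝ σ (s • y) (V y) := by
      rw [← integral_const_mul]; congr 1; funext y; ring
    have e4 : ∫ y, ‖V y‖ ^ 2 * (s * fderiv ℝ σ (s • y) y) = s * E' s := by
      rw [hE']; dsimp only; rw [← integral_const_mul]; congr 1; funext y; ring
    rw [e3, e4] at h
    have h' : s * ((2 / 5 : ℝ) * E' s + ∫ y, (‖V y‖ ^ 2 + 2 * P y) * fderiv ℝ σ (s • y) (V y)) = 0 := by
      linarith
    rcases mul_eq_zero.1 h' with h1 | h1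
    · exact absurd h1 hs.ne'
    · linarith
  -- `|∫ (|V|²+2P) Dσ(s y)[V y]| ≤ Kσ IF` for `s ∈ [1/(4L), 1/L]`
  have hflux : ∀ s ∈ Icc (1 / (4 * L)) (1 / L),
      |∫ y, (‖V y‖ ^ 2 + 2 * P y) * fderiv ℝ σ (s • y) (V y)| ≤ Kσ * IF := by
    intro s hs
    have hs0 : 0 < s := lt_of_lt_of_le (by positivity) hs.1
    have hdom : Integrable (S.indicator fun y => Kσ * F y) volume :=
      (hFS.integrable_indicator hSmeas).const_mul Kσ |>.congr (by
        refine Eventually.of_forall fun y => ?_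
        by_cases hy : y ∈ S <;> simp [indicator, hy])
    rw [hIF, ← integral_const_mul, ← integral_indicator hSmeas, ← Real.norm_eq_abs]
    refine norm_integral_le_of_norm_le hdom (Eventually.of_forall fun y => ?_)
    by_cases hg : fderiv ℝ σ (s • y) = 0
    · have h0 : fderiv ℝ σ (s • y) (V y) = 0 := by rw [hg]; rfl
      rw [h0, mul_zero, norm_zero]
      by_cases hy : y ∈ S
      · rw [indicator_of_mem hy]; exact mul_nonneg hKσ0 (hF0 y)
      · rw [indicator_of_notMem hy]
    · -- `y ∈ S` since `1/2 ≤ s|y| ≤ 1`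
      have hg' : gradient σ (s • y) ≠ 0 := by
        intro h0
        apply hg
        have : (InnerProductSpace.toDual ℝ (EuclideanSpace ℝ (Fin 3))).symm (fderiv ℝ σ (s • y)) = 0 := h0
        simpa using this
      have hsy := hσgrad _ hg'
      rw [norm_smul, Real.norm_eq_abs, abs_of_pos hs0] at hsy
      have hyS : y ∈ S := by
        refine ⟨?_, ?_⟩
        · by_contra hlt
          rw [not_le] at hlt
          have : s * ‖y‖ < (1 / L) * (L / 4) :=
            mul_lt_mul' hs.2 hlt (norm_nonneg _) (by positivity)
          have h2 : (1 / L) * (L / 4) = 1 / 4 := by field_simp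
          linarith [hsy.1]
        · by_contra hlt
          rw [not_le] at hlt
          have h1 : (1 / (4 * L)) * (8 * L) ≤ s * ‖y‖ :=
            mul_le_mul hs.1 hlt.le (by positivity) hs0.le
          have h2 : (1 / (4 * L)) * (8 * L) = 2 := by field_simp; ring
          linarith [hsy.2]
      rw [indicator_of_mem hyS, Real.norm_eq_abs, abs_mul]
      calc |‖V y‖ ^ 2 + 2 * P y| * |fderiv ℝ σ (s • y) (V y)|
          ≤ (‖V y‖ ^ 2 + 2 * |P y|) * (Kσ * ‖V y‖) := by
            refine mul_le_mul ?_ ?_ (abs_nonneg _) (by positivity)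
            · calc |‖V y‖ ^ 2 + 2 * P y| ≤ |‖V y‖ ^ 2| + |2 * P y| := abs_add_le _ _
                _ = ‖V y‖ ^ 2 + 2 * |P y| := by
                    rw [abs_of_nonneg (by positivity), abs_mul, abs_of_pos (by norm_num : (0:ℝ) < 2)]
            · rw [← Real.norm_eq_abs]
              exact (ContinuousLinearMap.le_opNorm _ _).trans
                (mul_le_mul_of_nonneg_right (hKσ _) (norm_nonneg _))
        _ = Kσ * F y := by rw [hF]; ring
  -- mean value inequality on `[1/(4L), 1/L]`
  have hE'bound : ∀ s ∈ Icc (1 / (4 * L)) (1 / L), ‖E' s‖ ≤ 5 / 2 * (Kσ * IF) := by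
    intro s hs
    have hs0 : 0 < s := lt_of_lt_of_le (by positivity) hs.1
    have h := hident s hs0
    have hE's : E' s = -(5 / 2) * ∫ y, (‖V y‖ ^ 2 + 2 * P y) * fderiv ℝ σ (s • y) (V y) := by
      linarith
    rw [hE's, norm_mul, Real.norm_eq_abs, Real.norm_eq_abs, abs_neg, abs_of_pos (by norm_num)]
    exact mul_le_mul_of_nonneg_left (hflux s hs) (by norm_num)
  have hMVT : ‖E (1 / (4 * L)) - E (1 / L)‖ ≤ 5 / 2 * (Kσ * IF) * ‖1 / (4 * L) - 1 / L‖ :=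
    (convex_Icc (1 / (4 * L)) (1 / L)).norm_image_sub_le_of_norm_hasDerivWithin_le
      (fun s hs => (hderiv s (lt_of_lt_of_le (by positivity) hs.1)).hasDerivWithinAt) hE'bound
      (right_mem_Icc.2 (by rw [div_le_div_iff_of_pos_left one_pos (by positivity) hL]; linarith))
      (left_mem_Icc.2 (by rw [div_le_div_iff_of_pos_left one_pos (by positivity) hL]; linarith))
  have hdist : ‖1 / (4 * L) - 1 / L‖ = 3 / (4 * L) := by
    rw [show 1 / (4 * L) - 1 / L = -(3 / (4 * L)) by field_simp; ring, norm_neg,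
      Real.norm_of_nonneg (by positivity)]
  rw [hdist] at hMVT
  -- integrability of the bump energies
  have hEint : ∀ {s : ℝ}, 0 < s → Integrable (fun y => ‖V y‖ ^ 2 * σ (s • y)) volume := by
    intro s hs
    have h := hV2.integrable_smul_left_of_hasCompactSupport
      (hσ.continuous.comp (continuous_const_smul s)) (hσc.comp_smul hs.ne')
    simpa [smul_eq_mul, mul_comm] using h
  -- `E(1/(4L)) ≥ ∫_{B̄_{2L}} |V|²` and `E(1/L) ≤ ∫_{B_L} |V|²` (adapted from the tree's lemma)
  have hs₂0 : (0 : ℝ) < 1 / (4 * L) := by positivity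
  have hs₁0 : (0 : ℝ) < 1 / L := by positivity
  have hV2cb : IntegrableOn (fun y => ‖V y‖ ^ 2) (closedBall (0 : EuclideanSpace ℝ (Fin 3)) (2 * L))
      volume := hV2.integrableOn_isCompact (isCompact_closedBall _ _)
  have hE₂ : ∫ y in closedBall (0 : EuclideanSpace ℝ (Fin 3)) (2 * L), ‖V y‖ ^ 2 ≤ E (1 / (4 * L)) := by
    rw [hE]; dsimp only
    rw [← integral_indicator measurableSet_closedBall]
    refine integral_mono (hV2cb.integrable_indicator measurableSet_closedBall) (hEint hs₂0)
      fun y => ?_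
    by_cases hy : y ∈ closedBall (0 : EuclideanSpace ℝ (Fin 3)) (2 * L)
    · rw [indicator_of_mem hy]
      have hy' : ‖(1 / (4 * L)) • y‖ ≤ 1 / 2 := by
        rw [mem_closedBall, dist_zero_right] at hy
        rw [norm_smul, Real.norm_eq_abs, abs_of_pos hs₂0]
        calc 1 / (4 * L) * ‖y‖ ≤ (1 / (4 * L)) * (2 * L) :=
              mul_le_mul_of_nonneg_left hy (by positivity)
          _ = 1 / 2 := by field_simp; ring
      rw [hσone _ hy', mul_one]
    · rw [indicator_of_notMem hy]
      exact mul_nonneg (by positivity) (hσ0 _)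
  have hV2b : IntegrableOn (fun y => ‖V y‖ ^ 2) (ball (0 : EuclideanSpace ℝ (Fin 3)) L) volume :=
    (hV2.integrableOn_isCompact (isCompact_closedBall 0 L)).mono_set ball_subset_closedBall
  have hE₁ : E (1 / L) ≤ ∫ y in ball (0 : EuclideanSpace ℝ (Fin 3)) L, ‖V y‖ ^ 2 := by
    rw [hE]; dsimp only
    rw [← integral_indicator measurableSet_ball]
    refine integral_mono (hEint hs₁0) (hV2b.integrable_indicator measurableSet_ball) fun y => ?_
    by_cases hy : y ∈ ball (0 : EuclideanSpace ℝ (Fin 3)) L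
    · rw [indicator_of_mem hy]
      exact mul_le_of_le_one_right (by positivity) (hσ1 _)
    · rw [indicator_of_notMem hy]
      have hy' : 1 ≤ ‖(1 / L) • y‖ := by
        rw [mem_ball, dist_zero_right, not_lt] at hy
        rw [norm_smul, Real.norm_eq_abs, abs_of_pos hs₁0]
        calc (1 : ℝ) = (1 / L) * L := by field_simp
          _ ≤ 1 / L * ‖y‖ := mul_le_mul_of_nonneg_left hy hs₁0.le
      rw [hσzero _ hy', mul_zero]
  have hshell : ∫ y in {y | L ≤ ‖y‖ ∧ ‖y‖ < 2 * L}, ‖V y‖ ^ 2 ≤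
      (∫ y in closedBall (0 : EuclideanSpace ℝ (Fin 3)) (2 * L), ‖V y‖ ^ 2) -
        ∫ y in ball (0 : EuclideanSpace ℝ (Fin 3)) L, ‖V y‖ ^ 2 := by
    rw [← setIntegral_sdiff measurableSet_ball hV2cb
      (ball_subset_closedBall.trans (closedBall_subset_closedBall (by linarith)))]
    have hsub : {y : EuclideanSpace ℝ (Fin 3) | L ≤ ‖y‖ ∧ ‖y‖ < 2 * L} ⊆
        closedBall (0 : EuclideanSpace ℝ (Fin 3)) (2 * L) \ ball 0 L := fun y hy =>
      ⟨by rw [mem_closedBall, dist_zero_right]; exact hy.2.le,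
        by rw [mem_ball, dist_zero_right, not_lt]; exact hy.1⟩
    exact setIntegral_mono_set (hV2cb.mono_set sdiff_subset)
      (Eventually.of_forall fun y => by positivity) hsub.eventuallyLE
  -- assemble
  have hfin : E (1 / (4 * L)) - E (1 / L) ≤ 5 / 2 * (Kσ * IF) * (3 / (4 * L)) :=
    (le_abs_self _).trans (Real.norm_eq_abs _ ▸ hMVT)
  calc ∫ y in {y | L ≤ ‖y‖ ∧ ‖y‖ < 2 * L}, ‖V y‖ ^ 2
      ≤ E (1 / (4 * L)) - E (1 / L) := hshell.trans (by linarith)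
    _ ≤ 5 / 2 * (Kσ * IF) * (3 / (4 * L)) := hfin
    _ = 15 * Kσ / 8 / L * IF := by field_simp; ring

end EndpointFlux

end Summit.NavierStokesRegularity.NavierStokesRegularity.Theorems.PowerGaugeEulerLiouville

end
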